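import Summits.HodgeConjecture.HodgeConjecture.Theorems.F0P3cStCharTSSaHeadTorus10    -- ★ (S-a) head: brings the organ's whole vocabulary (`Gqs`, `HLengthTwoLabels`, `xiLocalChar`, `finExplicitCollection`, `torusChart`, `vanDijkWeight`, …)
import Summits.HodgeConjecture.HodgeConjecture.Theorems.F0P3cStCharTSCartanFields      -- ★ p851300 (LH6-p01) S9a: (C1)(C3); (C2) mod CARTAN-NULL (brings ★ EllField S2)
import Summits.HodgeConjecture.HodgeConjecture.Theorems.F0P3cStCharTSLdsOpp           -- ★ p851264 (LH6-p05) S8b: `ldsCharactersOpposite_of_PS3`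
import Summits.HodgeConjecture.HodgeConjecture.Theorems.F0P3cStCharTSEllOpen           -- ★ p851296 (F0P2-p06) S8a: `isOpen_setOf_isRegularElt_and_not_mem_hyperbolicSet`
import Summits.HodgeConjecture.HodgeConjecture.Theorems.F0P3cStCharTSXiDict            -- ★ p851282 (LH6-p03) S6b (+ ★ p851228 KeysFields, LH6-p04): `keysFields_sockets`
import Summits.HodgeConjecture.HodgeConjecture.Theorems.F0P3cStCharTSL2dOfHcb          -- ★ p851304 (LH6-p02) S9c: `l2dEll_of_hcBounded`
import Summits.HodgeConjecture.HodgeConjecture.Theorems.F0P3cStCharTSParField          -- ★ p851306 (LH6-p03) S7 part 1: `parField_sockets`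
import Summits.HodgeConjecture.HodgeConjecture.Theorems.F0P3cStCharTSCartanNull        -- ★ p851303 (F0P3-p04) S9b′: `cartanNull_of_rootKernels`
import Summits.HodgeConjecture.HodgeConjecture.Theorems.F0P3cStCharTSLdsFields         -- ★ p851311 (LH6-p05) S5: `lds_sockets_of_ldsFields`
import Summits.HodgeConjecture.HodgeConjecture.Theorems.F0P3cStCharTSDefHGlue         -- ★ p851385 (LH4-p02) S12a: `defH_of_hcBoundedH`
import Summits.HodgeConjecture.HodgeConjecture.Theorems.F0P3cStCharTSPs3Lds          -- ★ (LH6-p02 g5) PS3-LDS: `ps3_of_ldsFields`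
import Summits.HodgeConjecture.HodgeConjecture.Theorems.F0P3cStCharTSU2OfUpDom       -- ★ (F0P3-p02) S13a: `l2UpOnTorus_of_upDom_LB` (DEAL #4 `_LB` twin, LH3-p03), `hcbUp_of_upDom`
import Summits.HodgeConjecture.HodgeConjecture.Theorems.F0P3cStCharTSGermThree      -- ★ (LH4-p03) S11: `germThree_local_of_germResidue`
import Summits.HodgeConjecture.HodgeConjecture.Theorems.F0P3cStCharTSPs2Assembly    -- ★ (LH6-p03) S7-2: `ps2_of_kinds`
import Summits.HodgeConjecture.HodgeConjecture.Theorems.F0P3cStCharTSUpDom          -- ★ (LH4-p01) S13c: `upDom_of_upDef`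
import Summits.HodgeConjecture.HodgeConjecture.Theorems.F0P3cStCharTSPsVanish       -- ★ (LH6-p04) PS-VANISH (V2): `char_eq_zero_on_ellG_of_isConstituentOf_irreducible`
import Summits.HodgeConjecture.HodgeConjecture.Theorems.F0P3cStCharTSEllClass       -- ★ (LH6-p03) ELL-CLASS: `ellipticClassification_of_redJH`
import Summits.HodgeConjecture.HodgeConjecture.Theorems.F0P3cStCharTSDGField        -- ★ p851395 (LH4-p02) DG-FIELD: `measurable_DG`, `DG_eq_zero_or_le`, `DG_coe_torus_eq_of_unit_rel` from the closed formula
import Summits.HodgeConjecture.HodgeConjecture.Theorems.F0P3cStCharTSDGFieldTwo     -- ★ p851405 (F0P3-p02) DG-FIELD-TWO: `continuous_dgFormulaTwo`, the two letters of the rank-2 closed formula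
import Summits.HodgeConjecture.HodgeConjecture.Theorems.F0P3cStCharTSDGLc           -- ★ (F0P3-p02) DG-LC: `DG_eventually_eq_of_mem_regG`
import Summits.HodgeConjecture.HodgeConjecture.Theorems.F0P3cStCharTSDHStable       -- ★ p851560 (LH4-p01) DH-STABLE: `hDHst_of_pin`
import Summits.HodgeConjecture.HodgeConjecture.Theorems.F0P3cStCharTSDHLc           -- ★ p851612 (F0P3-p02) DH-LC: `hDHlc_of_pin`
import Summits.HodgeConjecture.HodgeConjecture.Theorems.F0P3cStCharTSPs2Kind2Datum  -- ★ p851578 (LH6-p02) PS2-KIND2-DATUM: `ps2_kind2_of_fields` (the kind-2 trace identity `hK2` from `hSt`)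
import Summits.HodgeConjecture.HodgeConjecture.Theorems.F0P3cStCharTSUniqPar        -- ★ p851567 (LH6-p02) UNIQ-PAR: `uniqPar_of_fields` ((UNIQ-PAR) from Keys' list `hKeysRed`)
import Summits.HodgeConjecture.HodgeConjecture.Theorems.F0P3cStCharTSRedJH          -- ★ p851585∕RED-JH (LH6-p04) «RED-JH ⟸ KEYS-RED»: `ellipticClassification_of_keysRed` (brings ★ ELL-CLASS)
import Summits.HodgeConjecture.HodgeConjecture.Theorems.F0P3cStCharTSUprLi          -- ★ (F0P3-p02 g21) UPR-LI: `upRegularity_of_upDef` ((UPR) from (UP-DEF) modulo (HC-D) `hDGli`)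
import Summits.HodgeConjecture.HodgeConjecture.Theorems.F0P3cStCharTSUpTrSpecLB      -- ★ p852447 (F0P3-p02 g23) UP-TR PLUG: `upSpecLB_of_upTransferLB` (brings ★ UP-MEAS∀ p851766, ★ UP-CLASS, ★ def `Ch12Sec5.EllipticData.UpSpecLB` p852414)
import Summits.HodgeConjecture.HodgeConjecture.Theorems.F0P3cStCharTSUpTrDatumDict    -- ★ p852436 (F0P3-p02 g23) (P1) UP-TR DICTIONARY: `upTransferLB_of_concrete` (the concrete (A1′) display ↦ the `hUpTrLB` letter by the pins)
import Summits.HodgeConjecture.HodgeConjecture.Theorems.F0P3cStCharTSUpTrAssembly      -- ★ (A1′) FILE F (LH10-p01 g8) ROAD «UP-TR» terminus: `upTransferLB_concrete` (the p. 183 display, locally-bounded reading, on the organ's concrete data)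
import Summits.HodgeConjecture.HodgeConjecture.Theorems.F0P3cStCharTSDGFieldReg       -- ★ (LH4-p02) DG-FIELD-REG: `DG_conj` (D_G a class function, from the closed formula)
import Summits.HodgeConjecture.HodgeConjecture.Theorems.F0P3cStCharTSWeylDatumPinsWIF  -- ★ (LH5-p02 g7) WIF-AT-THE-DATUM by pins: `weylIntegrationFormula_of_datumPins` (M-socket ★ JAC-LOC inside; compact-torus socket `hJacT`)
import Summits.HodgeConjecture.HodgeConjecture.Theorems.F0P3cStCharTSCartanReps           -- ★ `exists_isRegularElt_centralizer_eq_cmTorus` (`M = Z(m₀)`, m₀ regular)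
import Summits.HodgeConjecture.HodgeConjecture.Theorems.F0P3cStCharTSJacCartanTerminus   -- ★ p852343 (LH5-p02 g7) JAC-ELL C8 terminus: `tubeJacobianSocket_compactCartan` (the compact-Cartan tube-Jacobian socket, IN HOUSE)
import Literature.NumberTheory.Rogawski1990.Ch12Sec7CharacterInputs                     -- ★ the named fact `normalizedCharacter_locallyBounded`
import HarnessLib

/-!
# F0 · P3c · line LH6 «StCharTS» — «DATUM-JUNCTION v8»: the BODY of the (S-𝔇) organ `stub_EllipticPackage` (leaf ED. 17, 47 conjuncts, TOKEN FOR TOKEN) for a GIVEN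
# datum `𝔇 d T par`, FROM the datum-road slices' FIELD EQUATIONS and the remaining NAMED INPUTS — the kernel-checked composition of the road (integrator file)

Cell `pub/hodgecm-mathlib`, crux H413 = `stmt-HodgeConjecture-24833` (lane `--supports …`), route HCCMUnconditional; seat LH6-p01 (g6) (datum-road map owner ∕ junction–rung-0 pen; heir of g5).
THEOREMS ONLY (no definition ∕ instance ∕ notation ∕ named fact ∕ `sorry`); ★-only imports (no `Lines` import: the organ's text is COPIED from
`Cruxes/H413/Lines/F0_P3c_StCharTSPaydown.lean` ED. 17 aea4fc928ec52218, decl :219, with `HLoc`∕`Pl` spelled out).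

WHAT.  `ellipticPackage_body_of_inputs₈`: under the organ's binder prefix (verbatim), for every `𝔇 d T par`:
* FIELD HYPOTHESES (road rule §2.1; each discharged by `rfl`∕`Iff.rfl`∕a ★ slice at the future concrete datum): COMPAT 1–7 (`hC01`–`hC07`), `hE` (`ellG = G^r ∖ Ω`, ★ S2),
  `hchar` (= (M1∀), the character family of ★ S1 CHAR-FIELD modulo §1.6), `hAll` (`cartanAll = {M} ∪ cartanG`), `hHaar` (`μT M` Haar), `hcart` (elliptic representatives =
  compact centralisers of regular elements), `hKeys` (★ S6∕S6b: `pi2∕piN` = the Keys-labelled pair for every `ξ′`), `hT3` (`T` = the type-(3) torus of ★ T3-LINK: no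
  `L_w`-rational eigenvalue on `T^{reg}`), `hHaarG`∕`hfinG`∕`hker` (★ S9b′ CARTAN-NULL: Haar + finite on the compact elliptic representatives, root-kernel cover of the
  singular set), `hDGm`∕`hDG` (★ S9c: `D_G` measurable, its HC-B junction on the elliptic tori), `hNL`∕`hPSpar`∕`hIrr` (★ S7: the `par`∕`irredPS` fields by choice),
  `hLdsF` (★ S5: `ldsPackets` = two-element JH-sets of the reducible unitary principal series);
* IN-FLIGHT slice kept as a VERBATIM conjunct hypothesis until its ★ lands: (DET) S4a;
* NAMED INPUTS (verbatim conjuncts): the carpets Prop. 12.5.2, [K] pseudo-coefficients, Prop. 12.6.1 (a)(b)(c), «elliptic ⟸ not principal series»,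
  the sockets (M1H)(UPR)(M5)(R0)(ST-L2)(UNIQ-PAR)(PL)(d > 0); ★ HC-B;
the CONCLUSION is the 47-conjunct body of (S-𝔇) with (E⊆R), (C1), (C2), (C3), (T3), (SPLIT-NOT-ELL), (PIN), (PI2-L2), `LdsCharactersOpposite`, (L2D-ell), (PS1),
(NONL2-PAR), (LDS), (LDS2), (DEF-H), (PS3), (U2), (HCB-up), (GERM-3), (PS2) DERIVED by the ★ slices S2 (p851227), S9a (p851300), S6b (p851282 over p851228), S8b (p851264) + S8a (p851296), S9b′ (p851303), S9c (p851304),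
S7 (p851306), S5 (p851311), S12a (p851385), PS3-LDS (LH6-p02 g5), S13a U2∕HCB-UP-OF-UPDOM (F0P3-p02) ∘ S13c UP-DOM ⟸ UP-DEF (p851529, LH4-p01), S11 GERM-3 local
(LH4-p03), S7-2 PS2-assembly (LH6-p03), ELL-CLASS ⟸ RED-JH (LH6-p03) over PS-VANISH (V2) (LH6-p04).  VERSION 8 (this file) SUPERSEDES v7 ★ p852368 (new file; same ∀-binders; the 47-conjunct conclusion byte for byte EXCEPT conjunct #9 `𝔇.UpSpec` ↦ `𝔇.UpSpecLB`).
ONE CHANGE v7 → v8 («UP-TR (j1) LB RE-LETTER», holder F0P3-p02 (g23) D1′, desk ruling 18:51Z, LEAD T14-26): the package conjunct ★ `Ch12Sec5.EllipticData.UpSpec` (print's `α ↦ α^G` letter,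
clause 3 for EVERY measurable stable `α` — a reading no absolutely convergent argument reaches) is replaced by ★ `Ch12Sec5.EllipticData.UpSpecLB` (p852414; clauses 1–2 unchanged, clause 3
under the LOCALLY-BOUNDED antecedent «`D_H · α` bounded on compacts of `H^r`» — true at every `α = packetCharH ρ` via the served ★ pin `hHBHP`), obtained by the ★ junction plug
`upSpecLB_of_upTransferLB` (p852447) from ★ UP-MEAS∀ ∕ UP-CLASS and the locally-bounded transfer display `hUpTrLB`; the (U2) consumer is re-pointed to the DEAL #4 twin ★
`l2UpOnTorus_of_upDom_LB` (statement = ★ `l2UpOnTorus_of_upDom` with `UpSpec ↦ UpSpecLB`; it consumes clause 1 only).  The display `hUpTrLB` is DERIVED in house: ★ `F0P3cStCharTSUpTrAssembly.upTransferLB_concrete` (ROAD «UP-TR» (A1′) terminus, on the organ's concrete data `νHv νQv mHv mQv μ`) folded by ★ (P1) `upTransferLB_of_concrete` (p852436) with the pins `hC01 hC02 hC06 eDG eDH hStH hRegH hUp`; NO new named input and NO new outer binder: `hUpTr` is GONE from the organ (block consequents 9 → 8, T14-26 (α)).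
HONEST LABEL (T14-26 (β), verbatim): «UP clause re-lettered to the locally-bounded reading of Rogawski p. 183 (true at every `α = packetCharH ρ` via ★ hHBHP); print's general-α
clause 3 is NOT claimed in house».  v7's census otherwise stands: WIF in house by ★ `weylIntegrationFormula_of_datumPins` from the pins `hcovA`∕`hncA`∕`hcptA`∕`hinvT`∕`hcoreT` and ★ JAC-ELL C8.
HONEST LABEL: HC_CM is proved only modulo the 7 printed citations (2 remaining named inputs: hLiu418 = `stmt-HodgeConjecture-24832`, h413 = `stmt-HodgeConjecture-24833`)
until rung 0 closes; this file closes no organ and introduces no new claim — it re-packages (S-𝔇)'s body over the ★ slices (count-neutral).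

## References
* [Rogawski1990] J. D. Rogawski, *Automorphic Representations of Unitary Groups in Three Variables*, Ann. of Math. Stud. 123 (1990): §12.5 pp. 182–187; §12.6 pp. 187–189;
  Lemma 12.7.2 (proof) pp. 191–194; §3.6 pp. 28–31; §12.2 pp. 172–174; §4.9 pp. 54–55.
* [Keys1984] D. Keys, *Principal series representations of special unitary groups over local fields*, Compositio Math. 51 (1984), §7.
* [HarishChandra1970] Harish-Chandra (notes by G. van Dijk), *Harmonic Analysis on Reductive p-adic Groups*, LNM 162 (1970): Part VII §1, Theorem 15.
-/

set_option autoImplicit false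
-- the mandated namespace has the single-problem summit's repeated segment (`HodgeConjecture.HodgeConjecture`)
set_option linter.dupNamespace false

noncomputable section

open NumberField IsDedekindDomain MeasureTheory Filter Topology
open scoped Matrix MatrixGroups NNReal ENNReal
open Literature.MeasureTheory.Group
open Literature.NumberTheory.Rogawski1990 Literature.NumberTheory.Automorphic Literature.NumberTheory.Automorphic.UnitaryGroup
open Literature.NumberTheory.Automorphic.UnitaryGroup.CotangentForms Literature.NumberTheory.GaloisRepresentations
open Literature.NumberTheory.Automorphic.Arthur2013.Leaves.TECR
open Summit.HodgeConjecture.HodgeConjecture.Cruxes.H413.F0P3cStCharTSTorusDefs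

namespace Summit.HodgeConjecture.HodgeConjecture.Cruxes.H413.F0P3cStCharTSDatumJunction8

open scoped Classical in
set_option maxHeartbeats 1600000 in
-- the statement is the (S-𝔇) organ's text (ED. 17), whose elaboration budget this matches
/-- **«DATUM-JUNCTION v8»: the body of (S-𝔇) from the slices' field equations and the named inputs.**  See the module docstring for the hypothesis census;
derived inside: (E⊆R) (C1) (C2) (C3) (T3) (SPLIT-NOT-ELL) (PIN) (PI2-L2) `LdsCharactersOpposite` (L2D-ell) (PS1) (NONL2-PAR) (LDS) (LDS2) (DEF-H) (PS3) (U2) (HCB-up) `UpSpecLB` (GERM-3) (PS2) `EllipticClassification` (UP-DOM) (UPR) (UNIQ-PAR) RED-JH DH-STABLE∕DH-LC DG-FIELD∕DG-LC (kind-2 trace identity) — everything else is passed through verbatim.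
[cite: Rogawski1990, §12.5 pp. 182–187; §12.6 pp. 187–189; Lemma 12.7.2 (proof) pp. 191–194] -/

theorem ellipticPackage_body_of_inputs₈ :
  ∀ (L : Type) [Field L] [NumberField L] [IsCMField L] (μ : HeckeCharacter L) (ξ : OneDimAutRepH L) (v : HeightOneSpectrum (𝓞 ↥(maximalRealSubfield L))),
    (∀ w : PlacesOver L v, IsCMField.complexConj L • w.1 = w.1) → μ.IsUnitary →
    (∀ x : Literature.NumberTheory.GaloisRepresentations.ideleGroup ↥(maximalRealSubfield L),
      μ (AdeleRing.ideleBaseChange (↥(maximalRealSubfield L)) L x) = quadraticHeckeCharCM L x) →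
    ∀ [MeasurableSpace (((UnitaryGroup.cmDatum L 2 (Matrix.of fun i j : Fin 2 => if i.val + j.val + 1 = 2 then (1 : L) else 0)).Local v × (UnitaryGroup.cmDatum L 1 (Matrix.of fun i j : Fin 1 => if i.val + j.val + 1 = 1 then (1 : L) else 0)).Local v))] [BorelSpace (((UnitaryGroup.cmDatum L 2 (Matrix.of fun i j : Fin 2 => if i.val + j.val + 1 = 2 then (1 : L) else 0)).Local v × (UnitaryGroup.cmDatum L 1 (Matrix.of fun i j : Fin 1 => if i.val + j.val + 1 = 1 then (1 : L) else 0)).Local v))] [MeasurableSpace (Gqs L v)] [BorelSpace (Gqs L v)]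
      (νHv : Measure (((UnitaryGroup.cmDatum L 2 (Matrix.of fun i j : Fin 2 => if i.val + j.val + 1 = 2 then (1 : L) else 0)).Local v × (UnitaryGroup.cmDatum L 1 (Matrix.of fun i j : Fin 1 => if i.val + j.val + 1 = 1 then (1 : L) else 0)).Local v))) (νQv : Measure (Gqs L v))
      [νHv.IsHaarMeasure] [νHv.IsMulRightInvariant] [νQv.IsHaarMeasure] [νQv.IsMulRightInvariant],
    letI : ∀ a : ((UnitaryGroup.cmDatum L 2 (Matrix.of fun i j : Fin 2 => if i.val + j.val + 1 = 2 then (1 : L) else 0)).Local v × (UnitaryGroup.cmDatum L 1 (Matrix.of fun i j : Fin 1 => if i.val + j.val + 1 = 1 then (1 : L) else 0)).Local v), MeasurableSpace (((UnitaryGroup.cmDatum L 2 (Matrix.of fun i j : Fin 2 => if i.val + j.val + 1 = 2 then (1 : L) else 0)).Local v × (UnitaryGroup.cmDatum L 1 (Matrix.of fun i j : Fin 1 => if i.val + j.val + 1 = 1 then (1 : L) else 0)).Local v) ⧸ Subgroup.centralizer ({a} : Set (((UnitaryGroup.cmDatum L 2 (Matrix.of fun i j : Fin 2 => if i.val + j.val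 + 1 = 2 then (1 : L) else 0)).Local v × (UnitaryGroup.cmDatum L 1 (Matrix.of fun i j : Fin 1 => if i.val + j.val + 1 = 1 then (1 : L) else 0)).Local v)))) := fun _ => borel _
    haveI : ∀ a : ((UnitaryGroup.cmDatum L 2 (Matrix.of fun i j : Fin 2 => if i.val + j.val + 1 = 2 then (1 : L) else 0)).Local v × (UnitaryGroup.cmDatum L 1 (Matrix.of fun i j : Fin 1 => if i.val + j.val + 1 = 1 then (1 : L) else 0)).Local v), BorelSpace (((UnitaryGroup.cmDatum L 2 (Matrix.of fun i j : Fin 2 => if i.val + j.val + 1 = 2 then (1 : L) else 0)).Local v × (UnitaryGroup.cmDatum L 1 (Matrix.of fun i j : Fin 1 => if i.val + j.val + 1 = 1 then (1 : L) else 0)).Local v) ⧸ Subgroup.centralizer ({a} : Set (((UnitaryGroup.cmDatum L 2 (Matrix.of fun i j : Fin 2 => if i.val + j.val + 1 = 2 then (1 : L) else 0)).Local v × (UnitaryGroup.cmDatum L 1 (Matrix.of fun i j : Fin 1 => if i.val + j.val + 1 = 1 then (1 : L) else 0)).Local v)))) := fun _ => ⟨rfl⟩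
    letI : ∀ γ : Gqs L v, MeasurableSpace (Gqs L v ⧸ Subgroup.centralizer ({γ} : Set (Gqs L v))) := fun _ => borel _
    haveI : ∀ γ : Gqs L v, BorelSpace (Gqs L v ⧸ Subgroup.centralizer ({γ} : Set (Gqs L v))) := fun _ => ⟨rfl⟩
    ∀ (mHv : OrbitalMeasureFamily (((UnitaryGroup.cmDatum L 2 (Matrix.of fun i j : Fin 2 => if i.val + j.val + 1 = 2 then (1 : L) else 0)).Local v × (UnitaryGroup.cmDatum L 1 (Matrix.of fun i j : Fin 1 => if i.val + j.val + 1 = 1 then (1 : L) else 0)).Local v))) (mQv : OrbitalMeasureFamily (Gqs L v)),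
      mHv.IsCanonical (IsLocalGRegular L v) νHv →
      mQv.IsCanonical (fun γ => IsRegularElt (γ.val : GL (Fin 3) (UnitaryGroup.LocalRing L v))) νQv →
      IsLocalDeltaTransferExists L (qsForm L) v ((finExplicitCollection L (qsForm L) μ (finExplicitDelta_conj_left_all L (qsForm L) μ) (finExplicitDelta_conj_right_all L (qsForm L) μ)) v) mHv mQv IsLocSmooth IsLocSmooth →
      ∀ (π₁ πSt : IrrClass (((UnitaryGroup.cmDatum L 2 (Matrix.of fun i j : Fin 2 => if i.val + j.val + 1 = 2 then (1 : L) else 0)).Local v × (UnitaryGroup.cmDatum L 1 (Matrix.of fun i j : Fin 1 => if i.val + j.val + 1 = 1 then (1 : L) else 0)).Local v))),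
        HLengthTwoLabels L v
          (torusCharPair (conjLocal L (IsCMField.complexConj L) v) (cmLocalForm L 2 v) (cmLocalForm_eq_over L 2 v) 0
            ((torusLocalComponent L (IsCMField.complexConj L) v ξ.η).comp
                (quotConj (conjLocal L (IsCMField.complexConj L) v) (conjLocal_conjLocal_cm L v)) *
              halfModulusChar (UnitaryGroup.LocalRing L v))
            (torusLocalComponent L (IsCMField.complexConj L) v ξ.ψ))
          ((torusLocalComponent L (IsCMField.complexConj L) v ξ.ψ).comp (localDet (IsCMField.complexConj L) v (isUnit_antidiagOne_det L 1))) π₁ πSt →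
        (∀ fH : ((UnitaryGroup.cmDatum L 2 (Matrix.of fun i j : Fin 2 => if i.val + j.val + 1 = 2 then (1 : L) else 0)).Local v × (UnitaryGroup.cmDatum L 1 (Matrix.of fun i j : Fin 1 => if i.val + j.val + 1 = 1 then (1 : L) else 0)).Local v) → ℂ, IsLocSmooth fH → π₁.smoothTrace νHv fH = charDist (ξ.xiLocalChar v) νHv fH) →
      ∀ [MeasurableSpace (Gqs L v ⧸ Subgroup.center (Gqs L v))] [BorelSpace (Gqs L v ⧸ Subgroup.center (Gqs L v))]
        (μZ : Measure (Gqs L v ⧸ Subgroup.center (Gqs L v))) [μZ.IsHaarMeasure],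
      ∀ (𝔇 : Ch12Sec5.EllipticData (Gqs L v) (((UnitaryGroup.cmDatum L 2 (Matrix.of fun i j : Fin 2 => if i.val + j.val + 1 = 2 then (1 : L) else 0)).Local v × (UnitaryGroup.cmDatum L 1 (Matrix.of fun i j : Fin 1 => if i.val + j.val + 1 = 1 then (1 : L) else 0)).Local v))) (d : IrrClass (Gqs L v) → ℝ) (T : Subgroup (Gqs L v))
        (par : IrrClass (Gqs L v) → (((UnitaryGroup.LocalRing L v)ˣ →* ℂˣ) × (↥(normOneUnits (conjLocal L (IsCMField.complexConj L) v)) →* ℂˣ))) (μv : (UnitaryGroup.LocalRing L v)ˣ →* ℂˣ),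
      -- hC01
      𝔇.μG = νQv →
      -- hC02
      𝔇.μH = νHv →
      -- hC03
      𝔇.μGZ = μZ →
      -- hC04
      𝔇.orb = mQv →
      -- hC05
      (∀ γ : Gqs L v, γ ∈ 𝔇.regG ↔ IsRegularElt (γ.val : GL (Fin 3) (UnitaryGroup.LocalRing L v))) →
      -- hC06
      (∀ (φ : Gqs L v → ℂ) (fH : ((UnitaryGroup.cmDatum L 2 (Matrix.of fun i j : Fin 2 => if i.val + j.val + 1 = 2 then (1 : L) else 0)).Local v × (UnitaryGroup.cmDatum L 1 (Matrix.of fun i j : Fin 1 => if i.val + j.val + 1 = 1 then (1 : L) else 0)).Local v) → ℂ), 𝔇.IsTransfer φ fH ↔ IsLocalDeltaTransfer L (qsForm L) v ((finExplicitCollection L (qsForm L) μ (finExplicitDelta_conj_left_all L (qsForm L) μ) (finExplicitDelta_conj_right_all L (qsForm L) μ)) v) mHv mQv fH φ) →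
      -- hC07
      ({πSt} : Finset (IrrClass (((UnitaryGroup.cmDatum L 2 (Matrix.of fun i j : Fin 2 => if i.val + j.val + 1 = 2 then (1 : L) else 0)).Local v × (UnitaryGroup.cmDatum L 1 (Matrix.of fun i j : Fin 1 => if i.val + j.val + 1 = 1 then (1 : L) else 0)).Local v)))) ∈ 𝔇.sqPacketsH →
      -- hE
      (∀ γ : Gqs L v, γ ∈ 𝔇.ellG ↔ IsRegularElt (γ.val : GL (Fin 3) (UnitaryGroup.LocalRing L v)) ∧ γ ∉ hyperbolicSet L v) →
      -- hchar
      (∀ π : IrrClass (Gqs L v), Measurable (𝔇.char π) ∧ LocallyIntegrable (𝔇.char π) 𝔇.μG ∧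
          (∀ x ∈ 𝔇.regG, ∀ᶠ y in 𝓝 x, 𝔇.char π y = 𝔇.char π x) ∧
          ∀ φ : Gqs L v → ℂ, IsLocSmooth φ → π.smoothTrace 𝔇.μG φ = ∫ x, φ x * 𝔇.char π x ∂𝔇.μG) →
      -- hAll
      (∀ T : Subgroup (Gqs L v), T ∈ 𝔇.cartanAll ↔ T = (cmBorelTriple L 3 v).M ∨ T ∈ 𝔇.cartanG) →
      -- hHaar
      (𝔇.μT (cmBorelTriple L 3 v).M).IsHaarMeasure →
      -- hcart
      (∀ T ∈ 𝔇.cartanG, IsCompact (T : Set (Gqs L v)) ∧ ∃ γ₀ : Gqs L v, IsRegularElt (γ₀.val : GL (Fin 3) (UnitaryGroup.LocalRing L v)) ∧ T = Subgroup.centralizer ({γ₀} : Set (Gqs L v))) →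
      -- hHaarG
      (∀ T ∈ 𝔇.cartanG, (𝔇.μT T).IsHaarMeasure) →
      -- hfinG
      (∀ T ∈ 𝔇.cartanG, IsFiniteMeasure (𝔇.μT T)) →
      -- hker
      (∀ T ∈ 𝔇.cartanG, ∃ s : Finset (Subgroup ↥T), (∀ K ∈ s, IsClosed (K : Set ↥T) ∧ ¬ IsOpen (K : Set ↥T)) ∧ ∀ t : ↥T, ¬ IsRegularElt ((t : Gqs L v).val : GL (Fin 3) (UnitaryGroup.LocalRing L v)) → ∃ K ∈ s, t ∈ K) →
      -- eDG
      (∀ g : Gqs L v, 𝔇.DG g = ((NNReal.sqrt (NNReal.sqrt ((∏ w : PlacesOver L v, IsNonarchimedeanLocalField.normAbs (w.1.adicCompletion L) (((g.val : GL (Fin 3) (UnitaryGroup.LocalRing L v)).val.charpoly.discr) w)) * ((∏ w : PlacesOver L v, IsNonarchimedeanLocalField.normAbs (w.1.adicCompletion L) (((g.val : GL (Fin 3) (UnitaryGroup.LocalRing L v)).val.det) w)) ^ 2)⁻¹)) : ℝ≥0) : ℝ)) →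
      -- eDH
      (∀ s : ((UnitaryGroup.cmDatum L 2 (Matrix.of fun i j : Fin 2 => if i.val + j.val + 1 = 2 then (1 : L) else 0)).Local v × (UnitaryGroup.cmDatum L 1 (Matrix.of fun i j : Fin 1 => if i.val + j.val + 1 = 1 then (1 : L) else 0)).Local v), 𝔇.DH s = ((NNReal.sqrt (NNReal.sqrt ((∏ w : PlacesOver L v, IsNonarchimedeanLocalField.normAbs (w.1.adicCompletion L) (((s.1.val : GL (Fin 2) (UnitaryGroup.LocalRing L v)).val.charpoly.discr) w)) * (∏ w : PlacesOver L v, IsNonarchimedeanLocalField.normAbs (w.1.adicCompletion L) (((s.1.val : GL (Fin 2) (UnitaryGroup.LocalRing L v)).val.det) w))⁻¹)) : ℝ≥0) : ℝ)) →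
      -- hKH
      (∀ T ∈ 𝔇.cartanH, IsCompact (T : Set ((UnitaryGroup.cmDatum L 2 (Matrix.of fun i j : Fin 2 => if i.val + j.val + 1 = 2 then (1 : L) else 0)).Local v × (UnitaryGroup.cmDatum L 1 (Matrix.of fun i j : Fin 1 => if i.val + j.val + 1 = 1 then (1 : L) else 0)).Local v))) →
      -- hFH
      (∀ T ∈ 𝔇.cartanH, IsFiniteMeasure (𝔇.μTH T)) →
      -- hHBH
      (∀ ρ ∈ 𝔇.sqPacketsH, ∀ T ∈ 𝔇.cartanH, ∀ C : Set ((UnitaryGroup.cmDatum L 2 (Matrix.of fun i j : Fin 2 => if i.val + j.val + 1 = 2 then (1 : L) else 0)).Local v × (UnitaryGroup.cmDatum L 1 (Matrix.of fun i j : Fin 1 => if i.val + j.val + 1 = 1 then (1 : L) else 0)).Local v), IsCompact C → C ⊆ (T : Set ((UnitaryGroup.cmDatum L 2 (Matrix.of fun i j : Fin 2 => if i.val + j.val + 1 = 2 then (1 : L) else 0)).Local v × (UnitaryGroup.cmDatum L 1 (Matrix.of fun i j : Fin 1 => if i.val + j.val + 1 = 1 then (1 : L) else 0)).Local v)) → ∃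 B : ℝ, ∀ γ ∈ C, ‖(𝔇.DH γ : ℂ) * 𝔇.packetCharH ρ γ‖ ≤ B) →
      -- hNL
      (∀ π : IrrClass (Gqs L v), ¬ π.IsSquareIntegrable μZ → π.IsConstituentOf (UnitaryGroup.cmPrincipalSeries L 3 v (UnitaryGroup.cmTorusCharPair L v (par π).1 (par π).2)) ∧ Continuous (par π).1 ∧ Continuous (par π).2) →
      -- hPSpar
      (∀ π : IrrClass (Gqs L v), (∃ (χ₁ : (UnitaryGroup.LocalRing L v)ˣ →* ℂˣ) (χ₂ : ↥(normOneUnits (conjLocal L (IsCMField.complexConj L) v)) →* ℂˣ), Continuous (fun x => ((χ₁ x : ℂˣ) : ℂ)) ∧ Continuous (fun x => ((χ₂ x : ℂˣ) : ℂ)) ∧ (UnitaryGroup.cmPrincipalSeries L 3 v (UnitaryGroup.cmTorusCharPair L v χ₁ χ₂)).IsIrreducible ∧ π.IsConstituentOf (UnitaryGroup.cmPrincipalSeries L 3 v (UnitaryGroup.cmTorusCharPair L v χ₁ χ₂))) → (UnitaryGroup.cmPrincipalSeries L 3 v (UnitaryGroup.cmTorusCharPair L v (par π).1 (par π).2)).IsIrreducible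 ∧ π.IsConstituentOf (UnitaryGroup.cmPrincipalSeries L 3 v (UnitaryGroup.cmTorusCharPair L v (par π).1 (par π).2)) ∧ Continuous (par π).1 ∧ Continuous (par π).2 ∧ Continuous (fun x => (((par π).1 x : ℂˣ) : ℂ)) ∧ Continuous (fun x => (((par π).2 x : ℂˣ) : ℂ)) ∧ ∀ (ν : Measure (Gqs L v)) (f : Gqs L v → ℂ), π.smoothTrace ν f = Representation.smoothTrace (G := Gqs L v) (UnitaryGroup.cmPrincipalSeries L 3 v (UnitaryGroup.cmTorusCharPair L v (par π).1 (par π).2)) ν f) →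
      -- hLdsF
      (∀ P : Finset (IrrClass (Gqs L v)), P ∈ 𝔇.ldsPackets ↔ (P.card = 2 ∧ ∃ (χ₁ : (UnitaryGroup.LocalRing L v)ˣ →* ℂˣ) (χ₂ : ↥(normOneUnits (conjLocal L (IsCMField.complexConj L) v)) →* ℂˣ), Continuous (fun x => ((χ₁ x : ℂˣ) : ℂ)) ∧ Continuous (fun x => ((χ₂ x : ℂˣ) : ℂ)) ∧ (∀ a : (UnitaryGroup.LocalRing L v)ˣ, (conjLocal L (IsCMField.complexConj L) v) (a : UnitaryGroup.LocalRing L v) = a → χ₁ a = 1) ∧ χ₁ ≠ 1 ∧ ∀ c : IrrClass (Gqs L v), c ∈ P ↔ c.IsConstituentOf (UnitaryGroup.cmPrincipalSeries L 3 v (UnitaryGroup.cmTorusCharPair L v χ₁ χ₂)))) →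
      -- hW
      (∀ (χ₁ : (UnitaryGroup.LocalRing L v)ˣ →* ℂˣ) (χ₂ : ↥(normOneUnits (conjLocal L (IsCMField.complexConj L) v)) →* ℂˣ), Continuous (fun x => ((χ₁ x : ℂˣ) : ℂ)) → Continuous (fun x => ((χ₂ x : ℂˣ) : ℂ)) → ∀ π π' : IrrClass (Gqs L v), ¬ π.IsSquareIntegrable μZ → ¬ π'.IsSquareIntegrable μZ → π.IsConstituentOf (UnitaryGroup.cmPrincipalSeries L 3 v (UnitaryGroup.cmTorusCharPair L v χ₁ χ₂)) → π'.IsConstituentOf (UnitaryGroup.cmPrincipalSeries L 3 v (UnitaryGroup.cmTorusCharPair L v χ₁ χ₂)) → par π = par π') →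
      -- hμq
      UnitaryGroup.IsQuadraticCharExtension (conjLocal L (IsCMField.complexConj L) v) μv →
      -- hμc
      (Continuous (fun x => ((μv x : ℂˣ) : ℂ))) →
      -- hStH
      (∀ a b : ((UnitaryGroup.cmDatum L 2 (Matrix.of fun i j : Fin 2 => if i.val + j.val + 1 = 2 then (1 : L) else 0)).Local v × (UnitaryGroup.cmDatum L 1 (Matrix.of fun i j : Fin 1 => if i.val + j.val + 1 = 1 then (1 : L) else 0)).Local v), 𝔇.stConjH a b ↔ IsLocalStablyConjH L v a b) →
      -- hRegH
      (∀ a : ((UnitaryGroup.cmDatum L 2 (Matrix.of fun i j : Fin 2 => if i.val + j.val + 1 = 2 then (1 : L) else 0)).Local v × (UnitaryGroup.cmDatum L 1 (Matrix.of fun i j : Fin 1 => if i.val + j.val + 1 = 1 then (1 : L) else 0)).Local v), IsLocalGRegular L v a → a ∈ 𝔇.regH) →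
      -- hUp
      (∀ (α : ((UnitaryGroup.cmDatum L 2 (Matrix.of fun i j : Fin 2 => if i.val + j.val + 1 = 2 then (1 : L) else 0)).Local v × (UnitaryGroup.cmDatum L 1 (Matrix.of fun i j : Fin 1 => if i.val + j.val + 1 = 1 then (1 : L) else 0)).Local v) → ℂ) (x : Gqs L v), 𝔇.up α x = if IsRegularElt (x.val : GL (Fin 3) (UnitaryGroup.LocalRing L v)) then ((𝔇.DG x : ℂ))⁻¹ * ∑ᶠ q : Quot (IsLocalStablyConjH L v), (if IsLocalGRegular L v q.out ∧ IsLocalNormPair L (qsForm L) v q.out x then finTau L v q.out μ * (𝔇.DH q.out : ℂ) * ((finKappaAt L v (qsForm L) q.out x : ℤ) : ℂ) * α q.out else 0) else 0) →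
      -- hHBHP
      (∀ ρ ∈ 𝔇.sqPacketsH, ∀ C : Set ((UnitaryGroup.cmDatum L 2 (Matrix.of fun i j : Fin 2 => if i.val + j.val + 1 = 2 then (1 : L) else 0)).Local v × (UnitaryGroup.cmDatum L 1 (Matrix.of fun i j : Fin 1 => if i.val + j.val + 1 = 1 then (1 : L) else 0)).Local v), IsCompact C → ∃ B : ℝ, ∀ s ∈ C, IsLocalGRegular L v s → ‖(𝔇.DH s : ℂ) * 𝔇.packetCharH ρ s‖ ≤ B) →
      -- hGerm
      (∃ (c : ℝ) (_ : c ≠ 0) (ι : Type) (S : Finset ι) (Λ : ι → ((Gqs L v) → ℂ) → ℂ) (Γ : ι → (Gqs L v) → ℂ) (γseq : ℕ → Gqs L v) (q : ℂ) (a : ι → ℕ) (g : ι → ℂ), (∀ f : (Gqs L v) → ℂ, IsLocSmooth f → ∀ᶠ γ in 𝓝[((T : Set (Gqs L v)) ∩ {γ | IsRegularElt (γ.val : GL (Fin 3) (UnitaryGroup.LocalRing L v))})] (1 : Gqs L v), classOrbitalIntegral mQv f (ConjClasses.mk γ) = (c : ℂ) * f 1 + ∑ u ∈ S, Λ u f *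 Γ u γ) ∧ (∀ n, γseq n ∈ (T : Set (Gqs L v)) ∧ IsRegularElt ((γseq n).val : GL (Fin 3) (UnitaryGroup.LocalRing L v))) ∧ Tendsto γseq atTop (𝓝 (1 : Gqs L v)) ∧ 1 < ‖q‖ ∧ (∀ u ∈ S, 1 ≤ a u) ∧ ∀ u ∈ S, ∀ n, Γ u (γseq n) = q ^ (n * a u) * g u) →
      -- hlabels
      (∀ ξ' : ((UnitaryGroup.cmDatum L 2 (Matrix.of fun i j : Fin 2 => if i.val + j.val + 1 = 2 then (1 : L) else 0)).Local v × (UnitaryGroup.cmDatum L 1 (Matrix.of fun i j : Fin 1 => if i.val + j.val + 1 = 1 then (1 : L) else 0)).Local v) →* ℂˣ, Continuous ξ' → ∃ (η₁ η₂ : ↥(normOneUnits (conjLocal L (IsCMField.complexConj L) v)) →* ℂˣ), Continuous (fun x => ((η₁ x : ℂˣ) : ℂ)) ∧ Continuous (fun x => ((η₂ x : ℂˣ) : ℂ)) ∧ KeysCaseTwoLabels L v μv η₁ η₂ (𝔇.pi2 ξ') (𝔇.piN ξ')) →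
      -- hSt
      (∀ ψ' : ↥(Subgroup.center (Gqs L v)) →* ℂˣ, Continuous ψ' → ∃ ψ : ↥(normOneUnits (conjLocal L (IsCMField.complexConj L) v)) →* ℂˣ, Continuous ψ ∧ 𝔇.stG ψ' ≠ 𝔇.detG ψ' ∧ ∀ c : IrrClass (Gqs L v), c.IsConstituentOf (UnitaryGroup.cmPrincipalSeries L 3 v (UnitaryGroup.cmTorusCharPair L v (halfModulusChar (UnitaryGroup.LocalRing L v) * halfModulusChar (UnitaryGroup.LocalRing L v))⁻¹ ψ)) ↔ (c = 𝔇.stG ψ' ∨ c = 𝔇.detG ψ')) →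
      -- hStJH
      (∀ ψ₀ : ↥(normOneUnits (conjLocal L (IsCMField.complexConj L) v)) →* ℂˣ, Continuous (fun x => ((ψ₀ x : ℂˣ) : ℂ)) → ∃ ψ : ↥(Subgroup.center (Gqs L v)) →* ℂˣ, Continuous ψ ∧ ∀ c : IrrClass (Gqs L v), c.IsConstituentOf (UnitaryGroup.cmPrincipalSeries L 3 v (UnitaryGroup.cmTorusCharPair L v (halfModulusChar (UnitaryGroup.LocalRing L v) * halfModulusChar (UnitaryGroup.LocalRing L v))⁻¹ ψ₀)) ↔ (c = 𝔇.stG ψ ∨ c = 𝔇.detG ψ)) →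
      -- hKeysJH
      (∀ (η₁ η₂ : ↥(normOneUnits (conjLocal L (IsCMField.complexConj L) v)) →* ℂˣ), Continuous (fun x => ((η₁ x : ℂˣ) : ℂ)) → Continuous (fun x => ((η₂ x : ℂˣ) : ℂ)) → ∃ ξ' : ((UnitaryGroup.cmDatum L 2 (Matrix.of fun i j : Fin 2 => if i.val + j.val + 1 = 2 then (1 : L) else 0)).Local v × (UnitaryGroup.cmDatum L 1 (Matrix.of fun i j : Fin 1 => if i.val + j.val + 1 = 1 then (1 : L) else 0)).Local v) →* ℂˣ, Continuous ξ' ∧ KeysCaseTwoLabels L v μv η₁ η₂ (𝔇.pi2 ξ') (𝔇.piN ξ')) →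
      -- hM1lc
      (∀ ρ ∈ 𝔇.sqPacketsH, ∀ a : ((UnitaryGroup.cmDatum L 2 (Matrix.of fun i j : Fin 2 => if i.val + j.val + 1 = 2 then (1 : L) else 0)).Local v × (UnitaryGroup.cmDatum L 1 (Matrix.of fun i j : Fin 1 => if i.val + j.val + 1 = 1 then (1 : L) else 0)).Local v), IsLocalGRegular L v a → ∀ᶠ a' in 𝓝 a, 𝔇.packetCharH ρ a' = 𝔇.packetCharH ρ a) →
      -- hcovA
      (∀ γ : Gqs L v, IsRegularElt (γ.val : GL (Fin 3) (UnitaryGroup.LocalRing L v)) → ∃ T' ∈ 𝔇.cartanAll, ∃ x : Gqs L v, ∀ g : Gqs L v, g ∈ Subgroup.centralizer ({γ} : Set (Gqs L v)) ↔ x⁻¹ * g * x ∈ T') →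
      -- hncA
      (∀ T' ∈ 𝔇.cartanAll, ∀ T'' ∈ 𝔇.cartanAll, T' ≠ T'' → ∀ y : Gqs L v, ¬ ∀ h : Gqs L v, h ∈ T'' ↔ y⁻¹ * h * y ∈ T') →
      -- hcptA
      (∀ T' ∈ 𝔇.cartanAll, T' ≠ (cmBorelTriple L 3 v).M → IsCompact (T' : Set (Gqs L v))) →
      -- hinvT
      (∀ T' ∈ 𝔇.cartanAll, (𝔇.μT T').IsInvInvariant) →
      -- hcoreT
      (∀ T' ∈ 𝔇.cartanAll, 𝔇.μT T' (compactCore ↥T') = 1) →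
      -- hIrr
      (∀ π ∈ 𝔇.irredPS, ∃ (χ₁ : (UnitaryGroup.LocalRing L v)ˣ →* ℂˣ) (χ₂ : ↥(normOneUnits (conjLocal L (IsCMField.complexConj L) v)) →* ℂˣ), Continuous (fun x => ((χ₁ x : ℂˣ) : ℂ)) ∧ Continuous (fun x => ((χ₂ x : ℂˣ) : ℂ)) ∧ (UnitaryGroup.cmPrincipalSeries L 3 v (UnitaryGroup.cmTorusCharPair L v χ₁ χ₂)).IsIrreducible ∧ π.IsConstituentOf (UnitaryGroup.cmPrincipalSeries L 3 v (UnitaryGroup.cmTorusCharPair L v χ₁ χ₂))) →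
      -- hKeys
      (∀ ξ' : ((UnitaryGroup.cmDatum L 2 (Matrix.of fun i j : Fin 2 => if i.val + j.val + 1 = 2 then (1 : L) else 0)).Local v × (UnitaryGroup.cmDatum L 1 (Matrix.of fun i j : Fin 1 => if i.val + j.val + 1 = 1 then (1 : L) else 0)).Local v) →* ℂˣ, (𝔇.pi2 ξ').IsSquareIntegrable 𝔇.μGZ ∧ ¬ (𝔇.piN ξ').IsSquareIntegrable 𝔇.μGZ) →
      -- hT3
      (∀ γ ∈ T, IsRegularElt (γ.val : GL (Fin 3) (UnitaryGroup.LocalRing L v)) → ∀ c : UnitaryGroup.LocalRing L v, ¬ ((γ.val.val : Matrix (Fin 3) (Fin 3) (UnitaryGroup.LocalRing L v)).charpoly).IsRoot c) →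
      -- hDet
      𝔇.DetNotL2 →
      -- hKeysRed
      (∀ (χ₁ : (UnitaryGroup.LocalRing L v)ˣ →* ℂˣ) (χ₂ : ↥(normOneUnits (conjLocal L (IsCMField.complexConj L) v)) →* ℂˣ), Continuous (fun x => ((χ₁ x : ℂˣ) : ℂ)) → Continuous (fun x => ((χ₂ x : ℂˣ) : ℂ)) → (∃ N : Subrepresentation (UnitaryGroup.cmPrincipalSeries L 3 v (UnitaryGroup.cmTorusCharPair L v χ₁ χ₂)), N ≠ ⊥ ∧ N ≠ ⊤) → (χ₁ = halfModulusChar (UnitaryGroup.LocalRing L v) * halfModulusChar (UnitaryGroup.LocalRing L v) ∨ χ₁ = (halfModulusChar (UnitaryGroup.LocalRing L v) * halfModulusChar (UnitaryGroup.LocalRing L v))⁻¹) ∨ (∃ η : (UnitaryGroup.LocalRing L v)ˣ →* ℂˣ, IsQuadraticCharExtension (conjLocal L (IsCMField.complexConj L) v) η ∧ Continuous (fun x => ((η x : ℂˣ) : ℂ)) ∧ (χ₁ = η * halfModulusChar (UnitaryGroup.LocalRing L v) ∨ χ₁ = η * (halfModulusChar (UnitaryGroup.LocalRing L v))⁻¹))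 ∨ (χ₁ ≠ 1 ∧ ∀ a : (UnitaryGroup.LocalRing L v)ˣ, (conjLocal L (IsCMField.complexConj L) v) (a : UnitaryGroup.LocalRing L v) = a → χ₁ a = 1)) →
      -- hLdsTwo
      (∀ (χ₁ : (UnitaryGroup.LocalRing L v)ˣ →* ℂˣ) (χ₂ : ↥(normOneUnits (conjLocal L (IsCMField.complexConj L) v)) →* ℂˣ), Continuous (fun x => ((χ₁ x : ℂˣ) : ℂ)) → Continuous (fun x => ((χ₂ x : ℂˣ) : ℂ)) → (∀ a : (UnitaryGroup.LocalRing L v)ˣ, (conjLocal L (IsCMField.complexConj L) v) (a : UnitaryGroup.LocalRing L v) = a → χ₁ a = 1) → χ₁ ≠ 1 → ∃ P : Finset (IrrClass (Gqs L v)), P.card = 2 ∧ ∀ c : IrrClass (Gqs L v), c ∈ P ↔ c.IsConstituentOf (UnitaryGroup.cmPrincipalSeries L 3 v (UnitaryGroup.cmTorusCharPair L v χ₁ χ₂))) →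
      -- hDGli
      LocallyIntegrable (fun x : Gqs L v => (𝔇.DG x)⁻¹) 𝔇.μG →
      -- h1252
      𝔇.Prop1252 →
      -- hPCE
      Ch12Sec6.PseudoCoeffExists 𝔇 →
      -- h61a
      Ch12Sec6.Prop1261a 𝔇 →
      -- h61b
      Ch12Sec6.Prop1261b 𝔇 →
      -- h61c
      Ch12Sec6.Prop1261c 𝔇 →
      -- hEllNotPS
      Ch12Sec6.EllipticOfNotPrincipalSeries 𝔇 →
      -- hM1H
      𝔇.PacketCharHRegularity →
      -- hM5
      𝔇.PacketCharHNorm →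
      -- hR0
      𝔇.LdsPseudoCoeffTraceH ({πSt} : Finset (IrrClass (((UnitaryGroup.cmDatum L 2 (Matrix.of fun i j : Fin 2 => if i.val + j.val + 1 = 2 then (1 : L) else 0)).Local v × (UnitaryGroup.cmDatum L 1 (Matrix.of fun i j : Fin 1 => if i.val + j.val + 1 = 1 then (1 : L) else 0)).Local v)))) →
      -- hStL2
      (∀ ψ' : ↥(Subgroup.center (Gqs L v)) →* ℂˣ, Continuous ψ' → 𝔇.IsL2 (𝔇.stG ψ')) →
      -- hPL
      (∀ (π : IrrClass (Gqs L v)) (f : Gqs L v → ℂ), 𝔇.IsL2 π → 𝔇.IsPseudoCoeff π f → f 1 = (d π : ℂ)) →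
      -- hdpos
      (∀ π : IrrClass (Gqs L v), 𝔇.IsL2 π → 0 < d π) →
      -- hHCB
      normalizedCharacter_locallyBounded →
        𝔇.μG = νQv ∧ 𝔇.μH = νHv ∧ 𝔇.μGZ = μZ ∧ 𝔇.orb = mQv ∧
        (∀ γ : Gqs L v, γ ∈ 𝔇.regG ↔ IsRegularElt (γ.val : GL (Fin 3) (UnitaryGroup.LocalRing L v))) ∧
        (∀ (φ : Gqs L v → ℂ) (fH : ((UnitaryGroup.cmDatum L 2 (Matrix.of fun i j : Fin 2 => if i.val + j.val + 1 = 2 then (1 : L) else 0)).Local v × (UnitaryGroup.cmDatum L 1 (Matrix.of fun i j : Fin 1 => if i.val + j.val + 1 = 1 then (1 : L) else 0)).Local v) → ℂ), 𝔇.IsTransfer φ fH ↔ IsLocalDeltaTransfer L (qsForm L) v ((finExplicitCollection L (qsForm L) μ (finExplicitDelta_conj_left_all L (qsForm L) μ) (finExplicitDelta_conj_right_all L (qsForm L) μ)) v) mHv mQv fH φ) ∧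
        ({πSt} : Finset (IrrClass (((UnitaryGroup.cmDatum L 2 (Matrix.of fun i j : Fin 2 => if i.val + j.val + 1 = 2 then (1 : L) else 0)).Local v × (UnitaryGroup.cmDatum L 1 (Matrix.of fun i j : Fin 1 => if i.val + j.val + 1 = 1 then (1 : L) else 0)).Local v)))) ∈ 𝔇.sqPacketsH ∧
        𝔇.WeylIntegrationFormula ∧ 𝔇.UpSpecLB ∧ 𝔇.Prop1252 ∧ Ch12Sec6.PseudoCoeffExists 𝔇 ∧
        Ch12Sec6.Prop1261a 𝔇 ∧ Ch12Sec6.Prop1261b 𝔇 ∧ Ch12Sec6.Prop1261c 𝔇 ∧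
        Ch12Sec6.LdsCharactersOpposite 𝔇 ∧ Ch12Sec6.EllipticOfNotPrincipalSeries 𝔇 ∧ Ch12Sec6.EllipticClassification 𝔇 ∧
        (∀ π : IrrClass (Gqs L v), Measurable (𝔇.char π) ∧ LocallyIntegrable (𝔇.char π) 𝔇.μG ∧
          (∀ x ∈ 𝔇.regG, ∀ᶠ y in 𝓝 x, 𝔇.char π y = 𝔇.char π x) ∧
          ∀ φ : Gqs L v → ℂ, IsLocSmooth φ → π.smoothTrace 𝔇.μG φ = ∫ x, φ x * 𝔇.char π x ∂𝔇.μG) ∧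
        𝔇.PacketCharHRegularity ∧ 𝔇.UpRegularity ∧ 𝔇.ellG ⊆ 𝔇.regG ∧
        (∀ π : IrrClass (Gqs L v), 𝔇.IsEllipticRep π → ∀ T ∈ 𝔇.cartanG, MemLp (fun t : ↥T => (𝔇.DG (t : Gqs L v) : ℂ) * 𝔇.char π (t : Gqs L v)) 2 (𝔇.μT T)) ∧ 𝔇.L2UpOnTorus ∧
        𝔇.DetNotL2 ∧ 𝔇.PiNNotL2 ∧ 𝔇.PacketCharHNorm ∧ (∀ ρ ∈ 𝔇.sqPacketsH, 𝔇.InnerHDefined (𝔇.packetCharH ρ) (𝔇.packetCharH ρ)) ∧ 𝔇.LdsNotL2 ∧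
        𝔇.EllCartanSubset ∧ 𝔇.EllCartanAE ∧ 𝔇.NonEllCartanAE ∧ 𝔇.LdsCardTwo ∧
        𝔇.LdsPseudoCoeffTraceH ({πSt} : Finset (IrrClass (((UnitaryGroup.cmDatum L 2 (Matrix.of fun i j : Fin 2 => if i.val + j.val + 1 = 2 then (1 : L) else 0)).Local v × (UnitaryGroup.cmDatum L 1 (Matrix.of fun i j : Fin 1 => if i.val + j.val + 1 = 1 then (1 : L) else 0)).Local v)))) ∧
        (∀ ψ' : ↥(Subgroup.center (Gqs L v)) →* ℂˣ, Continuous ψ' → 𝔇.IsL2 (𝔇.stG ψ')) ∧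
        (∀ ξ' : ((UnitaryGroup.cmDatum L 2 (Matrix.of fun i j : Fin 2 => if i.val + j.val + 1 = 2 then (1 : L) else 0)).Local v × (UnitaryGroup.cmDatum L 1 (Matrix.of fun i j : Fin 1 => if i.val + j.val + 1 = 1 then (1 : L) else 0)).Local v) →* ℂˣ, Continuous ξ' → 𝔇.IsL2 (𝔇.pi2 ξ')) ∧
        (∀ π ∈ 𝔇.irredPS, ¬ 𝔇.IsL2 π → ∀ f : Gqs L v → ℂ, IsLocSmooth f → π.smoothTrace νQv f = Representation.smoothTrace (G := Gqs L v) (UnitaryGroup.cmPrincipalSeries L 3 v (UnitaryGroup.cmTorusCharPair L v (par π).1 (par π).2)) νQv f) ∧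
        (∀ π σ : IrrClass (Gqs L v), ¬ 𝔇.IsL2 π → 𝔇.IsL2 σ → 𝔇.IsEllipticPair π σ → ∀ f : Gqs L v → ℂ, IsLocSmooth f →
            π.smoothTrace νQv f + σ.smoothTrace νQv f = Representation.smoothTrace (G := Gqs L v) (UnitaryGroup.cmPrincipalSeries L 3 v (UnitaryGroup.cmTorusCharPair L v (par π).1 (par π).2)) νQv f) ∧
        (∀ P ∈ 𝔇.ldsPackets, ∀ π' ∈ P, ∀ π'' ∈ P, π' ≠ π'' → par π'' = par π' ∧ ∀ f : Gqs L v → ℂ, IsLocSmooth f →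
            π'.smoothTrace νQv f + π''.smoothTrace νQv f = Representation.smoothTrace (G := Gqs L v) (UnitaryGroup.cmPrincipalSeries L 3 v (UnitaryGroup.cmTorusCharPair L v (par π').1 (par π').2)) νQv f) ∧
        (∀ π : IrrClass (Gqs L v), ¬ 𝔇.IsL2 π →
            π.IsConstituentOf (UnitaryGroup.cmPrincipalSeries L 3 v (UnitaryGroup.cmTorusCharPair L v (par π).1 (par π).2)) ∧
              Continuous (par π).1 ∧ Continuous (par π).2) ∧
        (∀ u u' : IrrClass (Gqs L v), ¬ 𝔇.IsL2 u → ¬ 𝔇.IsL2 u' →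
            (par u' = par u ∨ par u' = (conjInvChar (conjLocal L (IsCMField.complexConj L) v) (par u).1, (par u).2)) →
            u' = u ∨ ∃ P ∈ 𝔇.ldsPackets, u ∈ P ∧ u' ∈ P) ∧
        (∀ (π : IrrClass (Gqs L v)) (f : Gqs L v → ℂ), 𝔇.IsL2 π → 𝔇.IsPseudoCoeff π f → f 1 = (d π : ℂ)) ∧
        (∀ π : IrrClass (Gqs L v), 𝔇.IsL2 π → 0 < d π) ∧
        (∀ γ ∈ T, γ ∈ 𝔇.regG → γ ∈ 𝔇.ellG ∧
            ∀ z : (UnitaryGroup.cmDatum L 1 (Matrix.of fun i j : Fin 1 => if i.val + j.val + 1 = 1 then (1 : L) else 0)).Local v,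
              ¬ ((γ.val.val : Matrix (Fin 3) (Fin 3) (UnitaryGroup.LocalRing L v)).charpoly).IsRoot
                (((z.val.val : Matrix (Fin 1) (Fin 1) (UnitaryGroup.LocalRing L v))) 0 0)) ∧
        (∃ c : ℝ, c ≠ 0 ∧ ∀ f : Gqs L v → ℂ, IsLocSmooth f → ∃ α : Gqs L v → ℂ,
            (∀ᶠ γ in 𝓝[((T : Set (Gqs L v)) ∩ 𝔇.regG)] (1 : Gqs L v), 𝔇.orbInt γ f = (c : ℂ) * f 1 + α γ) ∧
            ∀ κ : ℂ, (∀ᶠ γ in 𝓝[((T : Set (Gqs L v)) ∩ 𝔇.regG)] (1 : Gqs L v), α γ = κ) → κ = 0) ∧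
        (∀ t : ↥(cmBorelTriple L 3 v).M, IsRegularElt ((((t : ↥(unitaryGroupOfForm (conjLocal L (IsCMField.complexConj L) v) (cmLocalForm L 3 v))) : Gqs L v).val : GL (Fin 3) (UnitaryGroup.LocalRing L v))) → ((t : ↥(unitaryGroupOfForm (conjLocal L (IsCMField.complexConj L) v) (cmLocalForm L 3 v))) : Gqs L v) ∉ 𝔇.ellG) ∧
        normalizedCharacter_locallyBounded ∧
          (∃ B : ℝ, ∀ m : ((LocalRing L v)ˣ × ↥(normOneUnits (conjLocal L (IsCMField.complexConj L) v))), m ∈ (((Submonoid.pi Set.univ (fun w : PlacesOver L v => (w.1.adicCompletionIntegers L).toSubring.toSubmonoid)).units.prod (⊤ : Subgroup ↥(normOneUnits (conjLocal L (IsCMField.complexConj L) v)))) : Subgroup ((LocalRing L v)ˣ × ↥(normOneUnits (conjLocal L (IsCMField.complexConj L) v)))) →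
            ‖(((vanDijkWeight L v (torusChart L v m)).re : ℝ) : ℂ) * 𝔇.up (𝔇.packetCharH {πSt}) (((torusChart L v m : ↥(cmBorelTriple L 3 v).M) : ↥(unitaryGroupOfForm (conjLocal L (IsCMField.complexConj L) v) (cmLocalForm L 3 v))) : Gqs L v)‖ ≤ B) := by
  intro L _ _ _ μ ξ v hns hμu hμω _ _ _ _ νHv νQv _ _ _ _ mHv mQv hcanH hcanQ hT_v π₁ πSt hlab hπ₁ _ _ μZ _ 𝔇 d T par μv
    hC01 hC02 hC03 hC04 hC05 hC06 hC07 hE hchar hAll hHaar hcart hHaarG hfinG hker eDG eDH hKH hFH hHBH hNL hPSpar hLdsF hW hμq hμc hStH hRegH hUp hHBHP hGerm hlabels hSt hStJH hKeysJH hM1lc hcovA hncA hcptA hinvT hcoreT hIrr hKeys hT3 hDet hKeysRed hLdsTwo hDGli h1252 hPCE h61a h61b h61c hEllNotPS hM1H hM5 hR0 hStL2 hPL hdpos hHCB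
  letI : ∀ a : ((UnitaryGroup.cmDatum L 2 (Matrix.of fun i j : Fin 2 => if i.val + j.val + 1 = 2 then (1 : L) else 0)).Local v × (UnitaryGroup.cmDatum L 1 (Matrix.of fun i j : Fin 1 => if i.val + j.val + 1 = 1 then (1 : L) else 0)).Local v), MeasurableSpace (((UnitaryGroup.cmDatum L 2 (Matrix.of fun i j : Fin 2 => if i.val + j.val + 1 = 2 then (1 : L) else 0)).Local v × (UnitaryGroup.cmDatum L 1 (Matrix.of fun i j : Fin 1 => if i.val + j.val + 1 = 1 then (1 : L) else 0)).Local v) ⧸ Subgroup.centralizer ({a} : Set ((UnitaryGroup.cmDatum L 2 (Matrix.of fun i j : Fin 2 => if i.val + j.val + 1 = 2 then (1 : L) else 0)).Local v × (UnitaryGroup.cmDatum L 1 (Matrix.of fun i j : Fin 1 => if i.val + j.val + 1 = 1 then (1 : L) else 0)).Local v))) := fun _ => borel _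
  haveI : ∀ a : ((UnitaryGroup.cmDatum L 2 (Matrix.of fun i j : Fin 2 => if i.val + j.val + 1 = 2 then (1 : L) else 0)).Local v × (UnitaryGroup.cmDatum L 1 (Matrix.of fun i j : Fin 1 => if i.val + j.val + 1 = 1 then (1 : L) else 0)).Local v), BorelSpace (((UnitaryGroup.cmDatum L 2 (Matrix.of fun i j : Fin 2 => if i.val + j.val + 1 = 2 then (1 : L) else 0)).Local v × (UnitaryGroup.cmDatum L 1 (Matrix.of fun i j : Fin 1 => if i.val + j.val + 1 = 1 then (1 : L) else 0)).Local v) ⧸ Subgroup.centralizer ({a} : Set ((UnitaryGroup.cmDatum L 2 (Matrix.of fun i j : Fin 2 => if i.val + j.val + 1 = 2 then (1 : L) else 0)).Local v × (UnitaryGroup.cmDatum L 1 (Matrix.of fun i j : Fin 1 => if i.val + j.val + 1 = 1 then (1 : L) else 0)).Local v))) := fun _ => ⟨rfl⟩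
  letI : ∀ γ : Gqs L v, MeasurableSpace (Gqs L v ⧸ Subgroup.centralizer ({γ} : Set (Gqs L v))) := fun _ => borel _
  haveI : ∀ γ : Gqs L v, BorelSpace (Gqs L v ⧸ Subgroup.centralizer ({γ} : Set (Gqs L v))) := fun _ => ⟨rfl⟩
  -- ★ DG-FIELD ∕ DG-LC: the `D_G` clauses from the closed formula `eDG`
  have hDGm : Measurable 𝔇.DG := F0P3cStCharTSDGField.measurable_DG L v 𝔇 eDG
  have hDG := F0P3cStCharTSDGField.DG_eq_zero_or_le L v 𝔇 eDG
  have hD5 := F0P3cStCharTSDGField.DG_coe_torus_eq_of_unit_rel L v 𝔇 eDG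
  have hDGlc := F0P3cStCharTSDGLc.DG_eventually_eq_of_mem_regG L v 𝔇 hC05 eDG
  -- ★ DG-FIELD-TWO ∕ DH-STABLE ∕ DH-LC: the `D_H` clauses from the closed formula `eDH`
  have h20 := F0P3cStCharTSDGFieldTwo.dgFormulaTwo_eq_zero_of_not_isUnit_discr L v (Matrix.of fun i j : Fin 2 => if i.val + j.val + 1 = 2 then (1 : L) else 0)
  have h2u := F0P3cStCharTSDGFieldTwo.dgFormulaTwo_eq_of_unit_rel L v (Matrix.of fun i j : Fin 2 => if i.val + j.val + 1 = 2 then (1 : L) else 0)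
  have hDHm : Measurable 𝔇.DH := by
    rw [show 𝔇.DH = _ from funext eDH]
    letI : MeasurableSpace ((UnitaryGroup.cmDatum L 2 (Matrix.of fun i j : Fin 2 => if i.val + j.val + 1 = 2 then (1 : L) else 0)).Local v) := borel _
    haveI : BorelSpace ((UnitaryGroup.cmDatum L 2 (Matrix.of fun i j : Fin 2 => if i.val + j.val + 1 = 2 then (1 : L) else 0)).Local v) := ⟨rfl⟩
    exact (F0P3cStCharTSDGFieldTwo.continuous_dgFormulaTwo L v (Matrix.of fun i j : Fin 2 => if i.val + j.val + 1 = 2 then (1 : L) else 0)).measurable.comp continuous_fst.measurable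
  have hDHst := F0P3cStCharTSDHStable.hDHst_of_pin L v 𝔇 (fun g : ((UnitaryGroup.cmDatum L 2 (Matrix.of fun i j : Fin 2 => if i.val + j.val + 1 = 2 then (1 : L) else 0)).Local v) => ((NNReal.sqrt (NNReal.sqrt ((∏ w : PlacesOver L v, IsNonarchimedeanLocalField.normAbs (w.1.adicCompletion L) (((g.val : GL (Fin 2) (UnitaryGroup.LocalRing L v)).val.charpoly.discr) w)) * (∏ w : PlacesOver L v, IsNonarchimedeanLocalField.normAbs (w.1.adicCompletion L) (((g.val : GL (Fin 2) (UnitaryGroup.LocalRing L v)).val.det) w))⁻¹)) : ℝ≥0) : ℝ)) h20 h2u eDH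
  have hDHlc := F0P3cStCharTSDHLc.hDHlc_of_pin L v 𝔇 (fun g : ((UnitaryGroup.cmDatum L 2 (Matrix.of fun i j : Fin 2 => if i.val + j.val + 1 = 2 then (1 : L) else 0)).Local v) => ((NNReal.sqrt (NNReal.sqrt ((∏ w : PlacesOver L v, IsNonarchimedeanLocalField.normAbs (w.1.adicCompletion L) (((g.val : GL (Fin 2) (UnitaryGroup.LocalRing L v)).val.charpoly.discr) w)) * (∏ w : PlacesOver L v, IsNonarchimedeanLocalField.normAbs (w.1.adicCompletion L) (((g.val : GL (Fin 2) (UnitaryGroup.LocalRing L v)).val.det) w))⁻¹)) : ℝ≥0) : ℝ)) h20 h2u eDH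
  -- ★ DG-FIELD-REG ∕ UP-MEAS ∕ UP-CLASS ∕ UP-TR PLUG: `UpSpecLB` = measurability + class-function property (in-house) + the LOCALLY-BOUNDED transfer display `hUpTrLB` (★ plug p852447)
  have hDGcl := F0P3cStCharTSDGFieldReg.DG_conj L v 𝔇 eDG
  have hUpTrLB : (∀ α : ((UnitaryGroup.cmDatum L 2 (Matrix.of fun i j : Fin 2 => if i.val + j.val + 1 = 2 then (1 : L) else 0)).Local v × (UnitaryGroup.cmDatum L 1 (Matrix.of fun i j : Fin 1 => if i.val + j.val + 1 = 1 then (1 : L) else 0)).Local v) → ℂ, Measurable α → Ch12Sec5.IsStableClassFunOn 𝔇.stConjH 𝔇.regH α → (∀ C : Set ((UnitaryGroup.cmDatum L 2 (Matrix.of fun i j : Fin 2 => if i.val + j.val + 1 = 2 then (1 : L) else 0)).Local v × (UnitaryGroup.cmDatum L 1 (Matrix.of fun i j : Fin 1 => if i.val + j.val + 1 = 1 then (1 : L) else 0)).Local v), IsCompact C → ∃ B : ℝ, ∀ s ∈ C, s ∈ 𝔇.regH → ‖(𝔇.DH s : ℂ) * α s‖ ≤ B) → ∀ f ∈ SchwartzBruhat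 (Gqs L v), ∀ fH : ((UnitaryGroup.cmDatum L 2 (Matrix.of fun i j : Fin 2 => if i.val + j.val + 1 = 2 then (1 : L) else 0)).Local v × (UnitaryGroup.cmDatum L 1 (Matrix.of fun i j : Fin 1 => if i.val + j.val + 1 = 1 then (1 : L) else 0)).Local v) → ℂ, 𝔇.IsTransfer f fH → Integrable (fun g => f g * 𝔇.up α g) 𝔇.μG → Integrable (fun h => fH h * α h) 𝔇.μH → ∫ g, f g * 𝔇.up α g ∂𝔇.μG = ∫ h, fH h * α h ∂𝔇.μH) := F0P3cStCharTSUpTrDatumDict.upTransferLB_of_concrete L v μ νHv νQv mHv mQv 𝔇 hC01 hC02 hC06 eDG eDH hStH hRegH hUp (F0P3cStCharTSUpTrAssembly.upTransferLB_concrete L v hns νHv νQv mHv mQv hcanH hcanQ μ hμu)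
  have hUpSpecLB : 𝔇.UpSpecLB := F0P3cStCharTSUpTrSpecLB.upSpecLB_of_upTransferLB L v μ hns 𝔇 hStH hRegH hDHst hDGm hDHm hDGcl hUp hUpTrLB
  -- ★ WIF-AT-THE-DATUM: the Weyl integration formula from the Cartan pins; the compact-Cartan tube-Jacobian socket by ★ JAC-ELL C8 `tubeJacobianSocket_compactCartan`, the M-socket ★ JAC-LOC inside the head
  have hShapeA : ∀ T' ∈ 𝔇.cartanAll, ∃ γ₀ : Gqs L v, IsRegularElt (γ₀.val : GL (Fin 3) (UnitaryGroup.LocalRing L v)) ∧ T' = Subgroup.centralizer ({γ₀} : Set (Gqs L v)) := fun T' hT' => by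
    rcases (hAll T').1 hT' with h | h
    · subst h; obtain ⟨m₀, -, hreg, hZ⟩ := F0P3cStCharTSCartanReps.exists_isRegularElt_centralizer_eq_cmTorus L v hns; exact ⟨m₀, hreg, hZ.symm⟩
    · exact (hcart T' h).2
  have hHaarT : ∀ T' ∈ 𝔇.cartanAll, (𝔇.μT T').IsHaarMeasure := fun T' hT' => by
    rcases (hAll T').1 hT' with h | h
    · subst h; exact hHaar
    · exact hHaarG T' h
  have hWIF : 𝔇.WeylIntegrationFormula := F0P3cStCharTSWeylDatumPinsWIF.weylIntegrationFormula_of_datumPins L v hns νQv mQv 𝔇 hC01 hC04 hcanQ hC05 hShapeA hcovA hncA hcptA hHaarT hinvT hcoreT eDG (F0P3cStCharTSJacCartanTerminus.tubeJacobianSocket_compactCartan L v hns νQv)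
  -- ★ PS2-KIND2-DATUM: the kind-2 trace identity from the Steinberg field clause `hSt`
  have hK2 := F0P3cStCharTSPs2Kind2Datum.ps2_kind2_of_fields hns μZ 𝔇 hC03 hSt par hNL νQv
  -- ★ UNIQ-PAR: (UNIQ-PAR) from Keys' reducibility list `hKeysRed`
  have hUNIQ := F0P3cStCharTSUniqPar.uniqPar_of_fields hns μZ 𝔇 hC03 hLdsF par hNL hKeysRed
  -- ★ UPR-LI: (UPR) from (UP-DEF), the `D_H`∕`D_G` regularity just derived, (M1H)'s stability clause, `hM1lc`, `hHBHP` and (HC-D) `hDGli`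
  have hUPR : 𝔇.UpRegularity := F0P3cStCharTSUprLi.upRegularity_of_upDef L v μ hμu hns 𝔇 hC05 hStH hRegH hDHst hDHlc hDGlc hUp (fun ρ hρ => (hM1H ρ hρ).2.2.1) hM1lc hHBHP hDGli
  exact ⟨hC01, hC02, hC03, hC04, hC05, hC06, hC07, hWIF, hUpSpecLB, h1252, hPCE, h61a, h61b, h61c, (F0P3cStCharTSLdsOpp.ldsCharactersOpposite_of_PS3 L v hns νQv mQv hcanQ 𝔇 hC01 hC05 (fun γ hγ => (hE γ).1 hγ) (F0P3cStCharTSEllOpen.isOpen_setOf_isRegularElt_and_not_mem_hyperbolicSet L v hns) hchar (F0P3cStCharTSLdsFields.lds_sockets_of_ldsFields hns μZ 𝔇 hC03 hLdsF).1 par (F0P3cStCharTSPs3Lds.ps3_of_ldsFields' hns μZ 𝔇 hLdsF par hNL hW νQv) (F0P3cStCharTSParField.parField_sockets 𝔇 μZ νQv par hNL hPSpar hIrr hC03).2), hEllNotPS, (F0P3cStCharTSRedJH.ellipticClassification_of_keysRed L v hns 𝔇 μv hμq hμc (F0P3cStCharTSPsVanish.char_eq_zero_on_ellG_of_isConstituentOf_irreducible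 L v hns νQv mQv hcanQ 𝔇 hC01 hC05 (fun γ hγ => (hE γ).1 hγ) hchar) (F0P3cStCharTSLdsFields.lds_sockets_of_ldsFields hns μZ 𝔇 hC03 hLdsF).2 hKeysRed hStJH hKeysJH hLdsF hLdsTwo), hchar, hM1H, hUPR, (F0P3cStCharTSEllField.ellG_subset_regG L v 𝔇 hC05 hE), (F0P3cStCharTSL2dOfHcb.l2dEll_of_hcBounded L v hHCB νQv 𝔇 hC01 hC05 hchar hDGm (fun T hT => (hcart T hT).1) hfinG hDG), (F0P3cStCharTSU2OfUpDom.l2UpOnTorus_of_upDom_LB 𝔇 (IsLocalGRegular L v) 3 hUpSpecLB hM1H hDGm (fun T hT => (hcart T hT).1) hfinG (F0P3cStCharTSUpDom.upDom_of_upDef L v μ hμu hns 𝔇 hC05 hStH hRegH hDHst hUp) hHBHP), hDet, (F0P3cStCharTSXiDict.keysFields_sockets 𝔇 𝔇.μGZ hKeys rfl rfl rfl).1, hM5, (F0P3cStCharTSDefHGlue.defH_of_hcBoundedH 𝔇 hM1H hDHm hKH hFH hHBH), (F0P3cStCharTSLdsFields.lds_sockets_of_ldsFields hns μZ 𝔇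 hC03 hLdsF).1, (fun T hT => (hAll T).2 (Or.inr hT)), (F0P3cStCharTSCartanFields.ellCartanAE_of_compact_centralizers L v 𝔇 hE hcart (F0P3cStCharTSCartanNull.cartanNull_of_rootKernels L v 𝔇 hHaarG (fun T hT => (hcart T hT).1) hker)), (F0P3cStCharTSCartanFields.nonEllCartanAE_of_split L v 𝔇 hC05 hE (fun T hT hTn => ((hAll T).1 hT).resolve_right hTn) hHaar), (F0P3cStCharTSLdsFields.lds_sockets_of_ldsFields hns μZ 𝔇 hC03 hLdsF).2, hR0, hStL2, (F0P3cStCharTSXiDict.keysFields_sockets 𝔇 𝔇.μGZ hKeys rfl rfl rfl).2, (F0P3cStCharTSParField.parField_sockets 𝔇 μZ νQv par hNL hPSpar hIrr hC03).1, (F0P3cStCharTSPs2Assembly.ps2_of_kinds hns μv hμq hμc μZ 𝔇 hC03 (F0P3cStCharTSLdsFields.lds_sockets_of_ldsFields hns μZ 𝔇 hC03 hLdsF).1 hStL2 hKeys hlabels par hNL νQv hK2), (F0P3cStCharTSPs3Lds.ps3_of_ldsFields' hns μZ 𝔇 hLdsF par hNL hW νQv), (F0P3cStCharTSParField.parField_sockets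 𝔇 μZ νQv par hNL hPSpar hIrr hC03).2, hUNIQ, hPL, hdpos, (fun γ hγ hreg => ⟨(hE γ).2 ⟨(hC05 γ).1 hreg, F0P3cStCharTSEllField.not_mem_hyperbolicSet_of_forall_not_isRoot L v (hT3 γ hγ ((hC05 γ).1 hreg))⟩, fun z => hT3 γ hγ ((hC05 γ).1 hreg) _⟩), (F0P3cStCharTSGermThree.germThree_local_of_germResidue L (qsForm L) v mQv 𝔇 hC04 hC05 T hGerm), (F0P3cStCharTSEllField.splitNotEll L v 𝔇 hE), hHCB, (F0P3cStCharTSU2OfUpDom.hcbUp_of_upDom L v hns 𝔇 (IsLocalGRegular L v) 3 hM1H (F0P3cStCharTSUpDom.upDom_of_upDef L v μ hμu hns 𝔇 hC05 hStH hRegH hDHst hUp) hHBHP πSt hC07 hD5)⟩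

end Summit.HodgeConjecture.HodgeConjecture.Cruxes.H413.F0P3cStCharTSDatumJunction8

end
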